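import Literature.Geometry.Riemannian.TubeChristoffelAxis
import Literature.Geometry.Lorentzian.OpensChartGeodesic
import Literature.Geometry.Lorentzian.CoordinateFrames
import HarnessLib

/-!
# The Christoffel term of the tube metric near the axis: `|⟪∇F, Γ(X, X)⟫| ≤ (2K + ε)‖X‖²‖∇F‖`

Topic `Geometry/Riemannian`. Continuing `TubeChristoffelAxis.lean`, which bounds the pairing of a
gradient `α ε₀ + β p` (`p ⊥ ε₀`) with the Christoffel form `Γ_x(X)(X)` of the tube metric AT the
points of the axis by `2K‖X‖²‖α ε₀ + β p‖` (`K` a bound for the geodesic curvature of the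
unit-speed core curve). Here the bound is extended to a thin solid tube around a compact axis
segment `{x₁ ε₀ : a ≤ x₁ ≤ b}`, at the cost of an arbitrary `ε > 0`:

* `continuous_christoffel_apply_self` — for a smooth metric `g_U` on `U : Opens V` with
  differentiable components, `(x, X) ↦ Γ_x(X)(X)` is continuous on `U × V` (the Christoffel data
  of a locally `C^∞` connection are smooth, `exists_contMDiffOn_christoffel`, and in the chart
  `U` they are the Christoffel map on the constant frame, `leviCivita_const_apply`);
* `christoffel_smul_smul` — `Γ_x(tX)(tX) = t² Γ_x(X)(X)`;
* `exists_abs_inner_christoffel_tube_le` — **for every `ε > 0` there is `δ > 0` such that at all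
  points `x` of `U` with `⟪ε₀, x⟫ ∈ [a, b]` and `‖x - ⟪ε₀, x⟫ε₀‖ < δ`:
  `|⟪α ε₀ + β p, Γ_x(X)(X)⟫| ≤ (2K + ε) ‖X‖² ‖α ε₀ + β p‖`** — uniform continuity of
  `(x, X) ↦ Γ_x(X)(X)` on a compact neighbourhood of (axis segment) × (unit ball), the axis bound
  `abs_inner_christoffel_tube_axis_le`, and scaling.

With `∇F = α ε₀ + β p` the gradient of the ellipsoid function this controls the Christoffel term
of the Hessian of `F`, hence the second fundamental form of Weinstein's thin ellipsoid
(Weinstein 1968, proof of the main theorem, step (2)), uniformly in the eccentricity.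

## References

* A. Weinstein, Ann. of Math. (2) 87 (1968), 29–41, proof of the main theorem, step (2).
  [cite: Weinstein1968]
* B. O'Neill, *Semi-Riemannian Geometry* (1983), Ch. 3, Prop. 13. [cite: ONeill1983, Ch. 3, Prop. 3.13]

Tags: [FermiCoordinates] [ChristoffelSymbols] [Weinstein1968]
-/

noncomputable section

open Bundle Set Filter Function InnerProductSpace TopologicalSpace Metric
open scoped Manifold ContDiff Topology RealInnerProductSpace

namespace Literature.Geometry.Riemannian

open Literature.Geometry.Lorentzian
open Literature.Geometry.Lorentzian.OpensChart
open Literature.Geometry.Lorentzian.PseudoRiemannianMetric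

/-! ### Continuity of the Christoffel form of a smooth chart metric -/

section Continuity

variable {V : Type*} [NormedAddCommGroup V] [InnerProductSpace ℝ V] [FiniteDimensional ℝ V]
  {U : Opens V}
  (gU : PseudoRiemannianMetric 𝓘(ℝ, V) ∞ V (TangentSpace 𝓘(ℝ, V) : U → Type _))
  (GU : V → V →L[ℝ] V →L[ℝ] ℝ)

/-- **`(x, X) ↦ Γ_x(X)(X)` is continuous** for a smooth metric on `U : Opens V` with
differentiable components: the Christoffel data of its (locally `C^∞`) Levi-Civita connection are
smooth (`exists_contMDiffOn_christoffel`), and in the chart `U` (identity trivialisation,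
constant coordinate frame) they are `w ↦ Γ_y(bᵢ)(w)` (`leviCivita_const_apply`); expand
`Γ_y(X)(X) = ∑ᵢ Xⁱ Γ_y(bᵢ)(X)`. [cite: ONeill1983, Ch. 3, Prop. 3.13] -/
theorem continuous_christoffel_apply_self [gU.HasLeviCivita] (hG : ∀ y : U, gU.val y = GU y)
    (hGd : ∀ y : U, DifferentiableAt ℝ GU y) :
    Continuous (fun q : U × V ↦ christoffel gU GU q.1 q.2 q.2) := by
  haveI : CompleteSpace V := FiniteDimensional.complete ℝ V
  haveI : Fact ((1 : ℕ∞ω) ≤ ∞) := ⟨by exact_mod_cast le_top⟩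
  rw [continuous_iff_continuousAt]
  rintro ⟨y₀, X₀⟩
  have hcov : gU.leviCivita.IsLocallyContMDiff ∞ :=
    gU.isLocallyContMDiff_leviCivita_holds ⊤ (le_refl _)
  set b := Module.finBasis ℝ V with hb
  obtain ⟨Ĉ, hĈ, hĈs⟩ := exists_contMDiffOn_christoffel gU.leviCivita hcov b y₀
  -- in the chart `U` the Christoffel data are the Christoffel map on the constant frame
  have hĈeq : ∀ (y : U) (i) (w : V), Ĉ i y w = christoffel gU GU y (b i) w := by
    intro y i w
    have hy : y ∈ (chartAt V y₀).source := by simp [OpensChart.chartAt_source]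
    have h := hĈ y hy i w
    rw [OpensChart.continuousLinearMapAt_trivializationAt_apply, OpensChart.trivializationAt_apply,
      localFrame_trivializationAt] at h
    rw [h]
    exact leviCivita_const_apply hG y (hGd y) (b i) w
  -- expansion in the basis
  have hexp : ∀ (y : U) (X : V), christoffel gU GU y X X = ∑ i, b.repr X i • Ĉ i y X := by
    intro y X
    conv_lhs => rw [← b.sum_repr X]
    rw [christoffel_sum]
    simp only [hĈeq, b.sum_repr]
  have hfun : (fun q : U × V ↦ christoffel gU GU q.1 q.2 q.2) =
      fun q : U × V ↦ ∑ i, b.repr q.2 i • Ĉ i q.1 q.2 := funext fun q ↦ hexp q.1 q.2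
  rw [hfun]
  refine (continuous_finsetSum _ fun i _ ↦ ?_).continuousAt
  have h1 : Continuous fun q : U × V ↦ Ĉ i q.1 := by
    have hc : ContinuousOn (Ĉ i) univ := by
      have := (hĈs i).continuousOn
      rwa [OpensChart.chartAt_source] at this
    exact (continuousOn_univ.1 hc).comp continuous_fst
  have h2 : Continuous fun q : U × V ↦ Ĉ i q.1 q.2 := h1.clm_apply continuous_snd
  have h3 : Continuous fun q : U × V ↦ b.repr q.2 i :=
    ((b.coord i).toContinuousLinearMap.continuous).comp continuous_snd
  exact h3.smul h2

omit [InnerProductSpace ℝ V] [FiniteDimensional ℝ V] in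
/-- `Γ_x(tX)(tX) = t² Γ_x(X)(X)`. [folklore] -/
theorem christoffel_smul_smul [NormedSpace ℝ V] [FiniteDimensional ℝ V] {m : ℕ∞ω}
    (g' : PseudoRiemannianMetric 𝓘(ℝ, V) m V (TangentSpace 𝓘(ℝ, V) : U → Type _))
    (G' : V → V →L[ℝ] V →L[ℝ] ℝ) (x : U) (t : ℝ) (X : V) :
    christoffel g' G' x (t • X) (t • X) = t ^ 2 • christoffel g' G' x X X := by
  rw [christoffel_smul, map_smul, smul_smul, sq]

end Continuity

/-! ### The bound on a thin tube -/

variable {V : Type*} [NormedAddCommGroup V] [InnerProductSpace ℝ V] [FiniteDimensional ℝ V]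
  {E : Type*} [NormedAddCommGroup E] [NormedSpace ℝ E] {H : Type*} [TopologicalSpace H]
  {I : ModelWithCorners ℝ E H} {M : Type*} [TopologicalSpace M] [ChartedSpace H M]
  [IsManifold I ∞ M] [FiniteDimensional ℝ E] [CompleteSpace E] [T2Space M] [BoundarylessManifold I M]
  {n : ℕ∞ω} [Fact (1 ≤ n)]
  (g : PseudoRiemannianMetric I n E (TangentSpace I : M → Type _)) [g.HasLeviCivita]
  [CovariantDerivative.ContMDiffCovariantDerivative g.leviCivita 1]
  [CovariantDerivative.ContMDiffCovariantDerivative g.leviCivita ((⊤ : ℕ∞) : ℕ∞ω)]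
  {c : ℝ → M} {e : Π t : ℝ, V →L[ℝ] TangentSpace I (c t)} {ε₀ : V}
  {U : Opens V}
  (gU : PseudoRiemannianMetric 𝓘(ℝ, V) ∞ V (TangentSpace 𝓘(ℝ, V) : U → Type _)) [gU.HasLeviCivita]
  (GU : V → V →L[ℝ] V →L[ℝ] ℝ)

set_option maxHeartbeats 400000 in
/-- **The Christoffel term near the axis.** Tube data: a Riemannian ambient metric, geodesically
complete; a unit-speed curve `c` with `g(D_t c', c') = 0` and `|D_t c'|²_g ≤ K²` on `[a, b]`; a
`g`-orthonormal adapted relatively parallel frame `e`; the tube map `Φ`. Model data: a smooth metric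
`g_U` on `U : Opens V` with differentiable components `G_U` which agree with the pulled-back form
`g(dΦ ·, dΦ ·)` on an open set `W ⊆ U` containing the axis segment `{x₁ε₀ : x₁ ∈ [a, b]}`. Then for
every `ε > 0` there is `δ > 0` such that for all `x ∈ U` with `⟪ε₀, x⟫ ∈ [a, b]` and
`‖x - ⟪ε₀, x⟫ε₀‖ < δ`, all `p ⊥ ε₀`, `α, β ∈ ℝ` and `X ∈ V`:
`|⟪α ε₀ + β p, Γ_x(X)(X)⟫| ≤ (2K + ε) ‖X‖² ‖α ε₀ + β p‖`.
[cite: Weinstein1968, proof of the main theorem, step (2)] -/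
theorem exists_abs_inner_christoffel_tube_le (hn : (∞ : ℕ∞ω) ≤ n) (hg : g.IsRiemannian)
    (hgc : IsGeodesicallyComplete g.leviCivita)
    (hs : ContMDiff (𝓘(ℝ, ℝ).prod 𝓘(ℝ, V)) I.tangent ∞
      (fun q : ℝ × V ↦ (TotalSpace.mk' E (c q.1) (e q.1 q.2) : TangentBundle I M)))
    (hε₀ : ‖ε₀‖ = 1) (he₀ : ∀ t, e t ε₀ = (velocity I c t : E))
    (hiso : ∀ t (u w : V), g.val (c t) (e t u) (e t w) = ⟪u, w⟫)
    (hpar : ∀ t (u : V), ⟪ε₀, u⟫ = 0 → covariantDerivAlong g.leviCivita c (fun t ↦ e t u) t =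
      -(g.val (c t) (e t u) (covariantDerivAlong g.leviCivita c (fun t ↦ velocity I c t) t)) •
        (velocity I c t))
    {a b : ℝ} {K : ℝ} (hK : 0 ≤ K)
    (hcurv : ∀ x₁ ∈ Icc a b, g.val (c x₁) (covariantDerivAlong g.leviCivita c (fun t ↦ velocity I c t) x₁)
      (covariantDerivAlong g.leviCivita c (fun t ↦ velocity I c t) x₁) ≤ K ^ 2)
    (hgeod : ∀ x₁ ∈ Icc a b, g.val (c x₁) (covariantDerivAlong g.leviCivita c (fun t ↦ velocity I c t) x₁)
      (velocity I c x₁) = 0)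
    (hG : ∀ y : U, gU.val y = GU y) (hGd : ∀ y : U, DifferentiableAt ℝ GU y)
    {W : Set V} (hW : IsOpen W) (hWU : W ⊆ (U : Set V)) (haxW : ∀ x₁ ∈ Icc a b, x₁ • ε₀ ∈ W)
    (hGU : ∀ v ∈ W, ∀ u w : V, GU v u w =
      g.val (expMap g.leviCivita (c ⟪ε₀, v⟫) (e ⟪ε₀, v⟫ (v - ⟪ε₀, v⟫ • ε₀)))
        (mfderiv 𝓘(ℝ, V) I (fun v : V ↦ expMap g.leviCivita (c ⟪ε₀, v⟫)
          (e ⟪ε₀, v⟫ (v - ⟪ε₀, v⟫ • ε₀))) v u)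
        (mfderiv 𝓘(ℝ, V) I (fun v : V ↦ expMap g.leviCivita (c ⟪ε₀, v⟫)
          (e ⟪ε₀, v⟫ (v - ⟪ε₀, v⟫ • ε₀))) v w))
    {ε : ℝ} (hε : 0 < ε) :
    ∃ δ : ℝ, 0 < δ ∧ ∀ x : U, ⟪ε₀, (x : V)⟫ ∈ Icc a b → ‖(x : V) - ⟪ε₀, (x : V)⟫ • ε₀‖ < δ →
      ∀ p : V, ⟪ε₀, p⟫ = 0 → ∀ (α β : ℝ) (X : V),
        |⟪α • ε₀ + β • p, christoffel gU GU x X X⟫| ≤ (2 * K + ε) * ‖X‖ ^ 2 * ‖α • ε₀ + β • p‖ := by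
  haveI : CompleteSpace V := FiniteDimensional.complete ℝ V
  have hcont := continuous_christoffel_apply_self gU GU hG hGd
  /- (1) a compact solid tube around the axis segment inside `W`, times the unit ball -/
  set Kax : Set V := (fun x₁ : ℝ ↦ x₁ • ε₀) '' Icc a b with hKax
  have hKaxc : IsCompact Kax := isCompact_Icc.image (continuous_id.smul continuous_const)
  have hKaxW : Kax ⊆ W := by rintro _ ⟨s, hs', rfl⟩; exact haxW s hs'
  obtain ⟨δ₀, hδ₀, hthick⟩ := hKaxc.exists_cthickening_subset_open hW hKaxW
  -- points of the closed `δ₀`-tube lie in `W ⊆ U`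
  have htubeW : ∀ v : V, ⟪ε₀, v⟫ ∈ Icc a b → ‖v - ⟪ε₀, v⟫ • ε₀‖ ≤ δ₀ → v ∈ W := by
    intro v hv hvr
    apply hthick
    rw [mem_cthickening_iff]
    refine le_trans (Metric.infEDist_le_edist_of_mem (⟨⟪ε₀, v⟫, hv, rfl⟩ : ⟪ε₀, v⟫ • ε₀ ∈ Kax)) ?_
    rw [edist_dist, dist_eq_norm]
    exact ENNReal.ofReal_le_ofReal hvr
  -- the compact set in `V × V` and its copy in `U × V`
  set C : Set (V × V) := {q | ⟪ε₀, q.1⟫ ∈ Icc a b ∧ ‖q.1 - ⟪ε₀, q.1⟫ • ε₀‖ ≤ δ₀ ∧ ‖q.2‖ ≤ 1}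
    with hC
  have hCsub : ∀ q ∈ C, q.1 ∈ (U : Set V) := fun q hq ↦ hWU (htubeW q.1 hq.1 hq.2.1)
  have hCc : IsCompact C := by
    haveI : ProperSpace V := FiniteDimensional.proper ℝ V
    apply Metric.isCompact_of_isClosed_isBounded
    · have hc1 : Continuous fun q : V × V ↦ ⟪ε₀, q.1⟫ := continuous_const.inner continuous_fst
      have hc2 : Continuous fun q : V × V ↦ ‖q.1 - ⟪ε₀, q.1⟫ • ε₀‖ :=
        (continuous_fst.sub (hc1.smul continuous_const)).norm
      have hc3 : Continuous fun q : V × V ↦ ‖q.2‖ := continuous_snd.norm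
      exact (isClosed_Icc.preimage hc1).inter
        ((isClosed_le hc2 continuous_const).inter (isClosed_le hc3 continuous_const))
    · rw [Metric.isBounded_iff_subset_closedBall (0 : V × V)]
      refine ⟨max |a| |b| + δ₀ + 1, fun q hq ↦ ?_⟩
      rw [mem_closedBall, dist_zero_right, Prod.norm_def, max_le_iff]
      obtain ⟨h1, h2, h3⟩ := hq
      constructor
      · have e1 : q.1 = (q.1 - ⟪ε₀, q.1⟫ • ε₀) + ⟪ε₀, q.1⟫ • ε₀ := by abel
        have e2 : ‖⟪ε₀, q.1⟫ • ε₀‖ = |⟪ε₀, q.1⟫| := by rw [norm_smul, Real.norm_eq_abs, hε₀, mul_one]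
        have e3 : |⟪ε₀, q.1⟫| ≤ max |a| |b| := abs_le_max_abs_abs h1.1 h1.2
        calc ‖q.1‖ = ‖(q.1 - ⟪ε₀, q.1⟫ • ε₀) + ⟪ε₀, q.1⟫ • ε₀‖ := by rw [← e1]
          _ ≤ ‖q.1 - ⟪ε₀, q.1⟫ • ε₀‖ + ‖⟪ε₀, q.1⟫ • ε₀‖ := norm_add_le _ _
          _ ≤ δ₀ + max |a| |b| := by rw [e2]; exact add_le_add h2 e3
          _ ≤ max |a| |b| + δ₀ + 1 := by linarith
      · linarith [le_max_left |a| |b|, abs_nonneg a, hδ₀.le]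
  set C' : Set (U × V) := {q | ⟪ε₀, (q.1 : V)⟫ ∈ Icc a b ∧ ‖(q.1 : V) - ⟪ε₀, (q.1 : V)⟫ • ε₀‖ ≤ δ₀ ∧
    ‖q.2‖ ≤ 1} with hC'
  have hC'c : IsCompact C' := by
    have hemb : Topology.IsEmbedding (Prod.map ((↑) : U → V) (id : V → V)) :=
      Topology.IsEmbedding.subtypeVal.prodMap Topology.IsEmbedding.id
    rw [hemb.isCompact_iff]
    have himg : Prod.map ((↑) : U → V) (id : V → V) '' C' = C := by
      ext q
      constructor
      · rintro ⟨q', hq', rfl⟩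
        exact hq'
      · intro hq
        exact ⟨(⟨q.1, hCsub q hq⟩, q.2), hq, rfl⟩
    rw [himg]
    exact hCc
  /- (2) uniform continuity of `(x, X) ↦ Γ_x(X)(X)` on `C'` -/
  have huc : UniformContinuousOn (fun q : U × V ↦ christoffel gU GU q.1 q.2 q.2) C' :=
    hC'c.uniformContinuousOn_of_continuous hcont.continuousOn
  obtain ⟨δ₁, hδ₁, hδ₁f⟩ := Metric.uniformContinuousOn_iff.1 huc ε hε
  /- (4) the radius -/
  refine ⟨min δ₀ δ₁, lt_min hδ₀ hδ₁, ?_⟩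
  intro x hx hxr p hp α β X
  have hxδ₀ : ‖(x : V) - ⟪ε₀, (x : V)⟫ • ε₀‖ ≤ δ₀ := (hxr.trans_le (min_le_left _ _)).le
  have hxδ₁ : ‖(x : V) - ⟪ε₀, (x : V)⟫ • ε₀‖ < δ₁ := hxr.trans_le (min_le_right _ _)
  -- the axis point below `x`
  set x₁ : ℝ := ⟪ε₀, (x : V)⟫ with hx₁
  have hyW : x₁ • ε₀ ∈ W := haxW x₁ hx
  set y : U := ⟨x₁ • ε₀, hWU hyW⟩ with hy
  -- the axis bound at `y`
  have hGy : ∀ a' b' : V, gU.val y a' b' = GU (y : V) a' b' := fun a' b' ↦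
    DFunLike.congr_fun (DFunLike.congr_fun (hG y) a') b'
  have hGUy : ∀ᶠ v in 𝓝 (x₁ • ε₀), ∀ u w : V, GU v u w =
      g.val (expMap g.leviCivita (c ⟪ε₀, v⟫) (e ⟪ε₀, v⟫ (v - ⟪ε₀, v⟫ • ε₀)))
        (mfderiv 𝓘(ℝ, V) I (fun v : V ↦ expMap g.leviCivita (c ⟪ε₀, v⟫)
          (e ⟪ε₀, v⟫ (v - ⟪ε₀, v⟫ • ε₀))) v u)
        (mfderiv 𝓘(ℝ, V) I (fun v : V ↦ expMap g.leviCivita (c ⟪ε₀, v⟫)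
          (e ⟪ε₀, v⟫ (v - ⟪ε₀, v⟫ • ε₀))) v w) := by
    filter_upwards [hW.mem_nhds hyW] with v hv
    exact hGU v hv
  have haxis : ∀ X' : V, |⟪α • ε₀ + β • p, christoffel gU GU y X' X'⟫| ≤
      2 * K * ‖X'‖ ^ 2 * ‖α • ε₀ + β • p‖ := fun X' ↦
    abs_inner_christoffel_tube_axis_le (c := c) (e := e) (ε₀ := ε₀) g gU GU hn hg hgc hs hε₀ he₀
      hiso hpar y x₁ rfl hGy hGUy (hGd y) hK (hcurv x₁ hx) (hgeod x₁ hx) hp α β X'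
  /- (5) the estimate, first for `‖X‖ ≤ 1` through uniform continuity, then by scaling -/
  have hnear : ∀ X' : V, ‖X'‖ ≤ 1 →
      ‖christoffel gU GU x X' X' - christoffel gU GU y X' X'‖ < ε := by
    intro X' hX'
    have hq : (x, X') ∈ C' := ⟨hx, hxδ₀, hX'⟩
    have hq' : (y, X') ∈ C' := by
      refine ⟨?_, ?_, hX'⟩
      · show ⟪ε₀, x₁ • ε₀⟫ ∈ Icc a b
        rw [inner_smul_unit_self hε₀]; exact hx
      · show ‖x₁ • ε₀ - ⟪ε₀, x₁ • ε₀⟫ • ε₀‖ ≤ δ₀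
        rw [inner_smul_unit_self hε₀, sub_self, norm_zero]; exact hδ₀.le
    have hd : dist (x, X') (y, X') < δ₁ := by
      rw [Prod.dist_eq, dist_self, max_eq_left dist_nonneg, Subtype.dist_eq, dist_eq_norm]
      show ‖(x : V) - x₁ • ε₀‖ < δ₁
      exact hxδ₁
    have h := hδ₁f _ hq _ hq' hd
    rw [dist_eq_norm] at h
    exact h
  -- scaling
  by_cases hX0 : X = 0
  · subst hX0
    have h0 : christoffel gU GU x (0 : V) (0 : V) = 0 := by rw [map_zero]
    rw [h0, inner_zero_right, abs_zero, norm_zero]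
    simp
  · have hXn : 0 < ‖X‖ := norm_pos_iff.2 hX0
    set X' : V := ‖X‖⁻¹ • X with hX'
    have hX'n : ‖X'‖ = 1 := by
      rw [hX', norm_smul, norm_inv, norm_norm, inv_mul_cancel₀ hXn.ne']
    have hXdec : X = ‖X‖ • X' := by
      rw [hX', smul_smul, mul_inv_cancel₀ hXn.ne', one_smul]
    have hsc : christoffel gU GU x X X = ‖X‖ ^ 2 • christoffel gU GU x X' X' := by
      conv_lhs => rw [hXdec]
      exact christoffel_smul_smul gU GU x ‖X‖ X'
    have hsc' : christoffel gU GU y X X = ‖X‖ ^ 2 • christoffel gU GU y X' X' := by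
      conv_lhs => rw [hXdec]
      exact christoffel_smul_smul gU GU y ‖X‖ X'
    -- split `Γ_x = Γ_y + (Γ_x - Γ_y)`
    set N : ℝ := ‖α • ε₀ + β • p‖ with hN
    have hN0 : 0 ≤ N := norm_nonneg _
    have h1 : |⟪α • ε₀ + β • p, christoffel gU GU y X X⟫| ≤ 2 * K * ‖X‖ ^ 2 * N := haxis X
    have h2 : |⟪α • ε₀ + β • p, christoffel gU GU x X X - christoffel gU GU y X X⟫| ≤
        N * (ε * ‖X‖ ^ 2) := by
      have h3 : christoffel gU GU x X X - christoffel gU GU y X X =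
          ‖X‖ ^ 2 • (christoffel gU GU x X' X' - christoffel gU GU y X' X') := by
        rw [hsc, hsc', smul_sub]
      rw [h3, inner_smul_right]
      have h4 := abs_real_inner_le_norm (α • ε₀ + β • p)
        (christoffel gU GU x X' X' - christoffel gU GU y X' X')
      have h5 := (hnear X' hX'n.le).le
      rw [abs_mul, abs_of_nonneg (sq_nonneg _)]
      calc ‖X‖ ^ 2 * |⟪α • ε₀ + β • p, christoffel gU GU x X' X' - christoffel gU GU y X' X'⟫|
          ≤ ‖X‖ ^ 2 * (N * ε) := by
            apply mul_le_mul_of_nonneg_left _ (sq_nonneg _)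
            exact h4.trans (mul_le_mul_of_nonneg_left h5 hN0)
        _ = N * (ε * ‖X‖ ^ 2) := by ring
    have hsplit : christoffel gU GU x X X =
        christoffel gU GU y X X + (christoffel gU GU x X X - christoffel gU GU y X X) := by abel
    rw [hsplit, inner_add_right]
    calc |⟪α • ε₀ + β • p, christoffel gU GU y X X⟫ +
          ⟪α • ε₀ + β • p, christoffel gU GU x X X - christoffel gU GU y X X⟫|
        ≤ |⟪α • ε₀ + β • p, christoffel gU GU y X X⟫| +
          |⟪α • ε₀ + β • p, christoffel gU GU x X X - christoffel gU GU y X X⟫| := abs_add_le _ _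
      _ ≤ 2 * K * ‖X‖ ^ 2 * N + N * (ε * ‖X‖ ^ 2) := add_le_add h1 h2
      _ = (2 * K + ε) * ‖X‖ ^ 2 * N := by ring

end Literature.Geometry.Riemannian

end
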